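import Mathlib
import HarnessLib

/-!
# Route `DiophantineDichotomy`, crux `KhovanskiiApproxTypeEv` (stmt-Schanuel-14972), line `lambert-liouville-kill`:
# stub `stub_challengerLevel` — level `(d, H)` of the rank-2 challenger `(1, p/q, α, q/(kp))`

Crux `Summit.Schanuel.Schanuel.Theses.DiophantineDichotomy.KhovanskiiApproxTypeEv` (item stmt-Schanuel-14972),
certificate line `lambert-liouville-kill` (skeleton `Cruxes/KhovanskiiApproxTypeEv/Lines/lambert_liouville_kill.lean`,
lead `prover-line-stmt-Schanuel-14972-a1-0`), registered stub `stub_challengerLevel` (landed `--supports stmt-Schanuel-14972`).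

In the rank-2 certificate `notLiouville_lambert_of_ev` the eventual crux `ApproxTypeEvAt 2 (1, x)` is fed the
challenger `γ = (1, p/q, α, q/(kp)) : Fin 2 ⊕ Fin 2 → ℂ` (`α` a root of a non-zero `P ∈ ℤ[X]` of degree `≤ d`
and height `≤ H`, `1 ≤ p`, `k p ≤ q ≤ H`).  This stub certifies its LEVEL `(d, H)`:
* `[ℚ(γ):ℚ] ≤ d`: `ℚ(γ) ≤ ℚ(α)` (the other three coordinates are rational), and
  `[ℚ(α):ℚ] = deg (minpoly α) ≤ deg P ≤ d` (`IntermediateField.adjoin.finrank`, `minpoly.degree_le_of_ne_zero`);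
* each coordinate is a root of a non-zero integer polynomial of degree `≤ d` and height `≤ H`:
  `X − 1`, `q X − p`, `P`, `(k p) X − q` (heights `1`, `max p q = q`, `≤ H`, `max (k p) q = q`, all `≤ H`).
Pattern of `Theorems/KhovanskiiApproxTypeEv/Negative/LoadBearing.lean` (`hfr`, `hcl` of
`not_approxTypeEvAt_const_one`).  Mathlib only.
-/

noncomputable section

-- `Summit.Schanuel.Schanuel.…` is the mandated summit/sub-problem namespace (single-conjunct summit), hence:
set_option linter.dupNamespace false

namespace Summit.Schanuel.Schanuel.Cruxes.KhovanskiiApproxTypeEv.LambertLiouvilleKill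

open Polynomial

/-- The linear integer certificate `u X − v` of a rational number `v/u`: for `1 ≤ u ≤ H`, `v ≤ H`,
`1 ≤ d` and any `z` with `u z = v`, the polynomial `C u * X − C v ∈ ℤ[X]` is non-zero, of degree
`≤ 1 ≤ d`, of height `max u v ≤ H`, and vanishes at `z`. [folklore] -/
theorem exists_linearCert (u v H d : ℕ) (hu : 1 ≤ u) (huH : u ≤ H) (hvH : v ≤ H) (hd : 1 ≤ d)
    (z : ℂ) (hz : (u : ℂ) * z = v) :
    ∃ Q : Polynomial ℤ, Q ≠ 0 ∧ Q.natDegree ≤ d ∧ (∀ j, |Q.coeff j| ≤ (H : ℤ)) ∧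
      Polynomial.aeval z Q = 0 := by
  have huH' : (u : ℤ) ≤ H := by exact_mod_cast huH
  have hvH' : (v : ℤ) ≤ H := by exact_mod_cast hvH
  have hu' : (1 : ℤ) ≤ u := by exact_mod_cast hu
  refine ⟨C (u : ℤ) * X - C (v : ℤ), ?_, ?_, ?_, ?_⟩
  · intro h
    have h1 : (C (u : ℤ) * X - C (v : ℤ)).coeff 1 = (u : ℤ) := by
      simp [coeff_sub]
    rw [h, coeff_zero] at h1
    omega
  · calc (C (u : ℤ) * X - C (v : ℤ)).natDegree
        ≤ max (C (u : ℤ) * X).natDegree (C (v : ℤ)).natDegree := natDegree_sub_le _ _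
      _ ≤ 1 := max_le ((natDegree_C_mul_le _ _).trans natDegree_X_le)
          (by rw [natDegree_C]; exact Nat.zero_le _)
      _ ≤ d := hd
  · intro j
    rw [coeff_sub, coeff_C_mul, coeff_X, coeff_C]
    split_ifs <;> simp <;> omega
  · have h : Polynomial.aeval z (C (u : ℤ) * X - C (v : ℤ)) = (u : ℂ) * z - v := by
      simp
    rw [h, hz, sub_self]

/-- **STUB 4 (level of the challenger).**  For `α` a root of a non-zero `P ∈ ℤ[X]` of degree `≤ d`
and height `≤ H`, and `1 ≤ p`, `k p ≤ q ≤ H` (`1 ≤ k`, `1 ≤ d`), the challenger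
`γ = (1, p/q, α, q/(kp)) ∈ ℚ(α)⁴` has `[ℚ(γ):ℚ] ≤ [ℚ(α):ℚ] = deg (minpoly_ℚ α) ≤ deg P ≤ d`, and its
coordinates are roots of `X − 1`, `q X − p`, `P`, `(k p) X − q` — all non-zero, of degree `≤ d` and
height `≤ H` (as `p ≤ k p ≤ q ≤ H`).  Proof: `ℚ(γ) ≤ ℚ(α)` by `IntermediateField.adjoin_le_iff`
(`1`, `p/q`, `q/(kp)` lie in every intermediate field), `IntermediateField.finrank_le_of_le_right`,
`IntermediateField.adjoin.finrank`, `minpoly.degree_le_of_ne_zero` on `P.map (Int.castRingHom ℚ)`;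
the certificates by `exists_linearCert`. [folklore; pattern of `Negative/LoadBearing.lean`] -/
theorem stub_challengerLevel :
    ∀ (d k p q H : ℕ) (α : ℂ) (P : ℤ[X]), 1 ≤ d → 1 ≤ k → 1 ≤ p → k * p ≤ q → q ≤ H →
      P ≠ 0 → Polynomial.aeval α P = 0 → P.natDegree ≤ d → (∀ i, |P.coeff i| ≤ (H : ℤ)) →
      Module.finrank ℚ ↥(IntermediateField.adjoin ℚ
          (Set.range (Sum.elim ![(1 : ℂ), (p : ℂ) / q] ![α, (q : ℂ) / (k * p)]))) ≤ d ∧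
        ∀ i, ∃ Q : Polynomial ℤ, Q ≠ 0 ∧ Q.natDegree ≤ d ∧ (∀ j, |Q.coeff j| ≤ (H : ℤ)) ∧
          Polynomial.aeval (Sum.elim ![(1 : ℂ), (p : ℂ) / q] ![α, (q : ℂ) / (k * p)] i) Q = 0 := by
  intro d k p q H α P hd hk hp hkpq hqH hP0 hPα hPdeg hPcoef
  -- elementary size bookkeeping: 1 ≤ p ≤ k p ≤ q ≤ H
  have hpkp : p ≤ k * p := Nat.le_mul_of_pos_left p (by omega)
  have hkp1 : 1 ≤ k * p := le_trans hp hpkp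
  have hq1 : 1 ≤ q := le_trans hkp1 hkpq
  have hH1 : 1 ≤ H := le_trans hq1 hqH
  have hpH : p ≤ H := le_trans (le_trans hpkp hkpq) hqH
  have hkpH : k * p ≤ H := le_trans hkpq hqH
  have hq0 : (q : ℂ) ≠ 0 := by exact_mod_cast (show q ≠ 0 by omega)
  have hk0 : (k : ℂ) ≠ 0 := by exact_mod_cast (show k ≠ 0 by omega)
  have hp0 : (p : ℂ) ≠ 0 := by exact_mod_cast (show p ≠ 0 by omega)
  -- α is algebraic over ℚ, annihilated by `P.map (Int.castRingHom ℚ) ≠ 0`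
  have hPQ0 : P.map (Int.castRingHom ℚ) ≠ 0 :=
    (Polynomial.map_ne_zero_iff (Int.castRingHom ℚ).injective_int).mpr hP0
  have hPQα : Polynomial.aeval α (P.map (Int.castRingHom ℚ)) = 0 := by
    rw [← algebraMap_int_eq, aeval_map_algebraMap]; exact hPα
  have hαint : IsIntegral ℚ α := (show IsAlgebraic ℚ α from ⟨_, hPQ0, hPQα⟩).isIntegral
  refine ⟨?_, ?_⟩
  · -- `ℚ(γ) ≤ ℚ(α)` and `[ℚ(α):ℚ] = natDegree (minpoly ℚ α) ≤ natDegree P ≤ d`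
    have hle : IntermediateField.adjoin ℚ
          (Set.range (Sum.elim ![(1 : ℂ), (p : ℂ) / q] ![α, (q : ℂ) / (k * p)])) ≤
        IntermediateField.adjoin ℚ {α} := by
      rw [IntermediateField.adjoin_le_iff]
      rintro _ ⟨i, rfl⟩
      rcases i with i | i <;> fin_cases i
      · exact one_mem _
      · exact div_mem (natCast_mem _ p) (natCast_mem _ q)
      · exact IntermediateField.mem_adjoin_simple_self ℚ α
      · exact div_mem (natCast_mem _ q) (mul_mem (natCast_mem _ k) (natCast_mem _ p))
    haveI : FiniteDimensional ℚ (IntermediateField.adjoin ℚ {α}) :=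
      IntermediateField.adjoin.finiteDimensional hαint
    refine (IntermediateField.finrank_le_of_le_right hle).trans ?_
    rw [IntermediateField.adjoin.finrank hαint]
    refine le_trans ?_ hPdeg
    have h' := natDegree_le_natDegree (minpoly.degree_le_of_ne_zero ℚ α hPQ0 hPQα)
    rwa [natDegree_map_eq_of_injective (Int.castRingHom ℚ).injective_int] at h'
  · -- the four certificates `X − 1`, `q X − p`, `P`, `(k p) X − q`
    refine Sum.forall.mpr ⟨Fin.forall_fin_two.mpr ⟨?_, ?_⟩, Fin.forall_fin_two.mpr ⟨?_, ?_⟩⟩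
    · exact exists_linearCert 1 1 H d le_rfl hH1 hH1 hd 1 (by norm_num)
    · exact exists_linearCert q p H d hq1 hqH hpH hd ((p : ℂ) / q) (by field_simp)
    · exact ⟨P, hP0, hPdeg, hPcoef, hPα⟩
    · exact exists_linearCert (k * p) q H d hkp1 hkpH hqH hd ((q : ℂ) / (k * p))
        (by push_cast; field_simp)

end Summit.Schanuel.Schanuel.Cruxes.KhovanskiiApproxTypeEv.LambertLiouvilleKill

end
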